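import Summits.QuantumFields.BalabanUV.Gaps.CapSignsConstRoad
import Summits.QuantumFields.BalabanUV.Beta.CapRowsTail
import Summits.QuantumFields.BalabanUV.Beta.RemainderExplicitSplitUnique
import Literature.MathematicalPhysics.QuantumFieldTheory.Balaban1983to89.Beta.LargeL

/-!
# Gaps / CapTailFloors — the β⁰-side of «CAP+tail» in FLOOR currency on the every-slope road: an EVENTUAL floor of the one-loop coefficients
# feeds the END statement (rung L1.2), a UNIFORM floor feeds Theorem 2 as printed ((0.31)); uniform = eventual ∧ the CAP's SIGN list (the
# CAP-vs-tail split certificate); the floor's suppliers BY NAME (rate + one certified value; the CAP-k row carrier `Beta.CapRows.Rows` with the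
# tail sockets `Beta.CapRowsTail.MonotoneTailUp ∕ MonotoneTailDown ∕ ContractingTail`); companion of `Gaps/CapSignsConstRoad.lean`
# (cell pub-balaban-gaps, seat g1-p3 gen 2, CAP+tail «split ∕ weakening» charge)

HONEST FRAMING (cell rule, page 1 of everything): bookkeeping over the β sub-cell's hypothesis carriers; NOTHING of Bałaban's is asserted
beyond print; [Balaban1987RG1] Thm 2 is UNPROVED IN PRINT; 0 coefficients certified to date (row CAP-k); one finite T⁴; 0∕13 main theorems,
0∕9 spine estimates; NOT `BetaPertH`, NOT the continuum limit, NOT Clay.  HONEST DEPENDENCY (b2b cell, verbatim): «continuum YM on T⁴ ⇐ BetaPertH ∧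
nine spine estimates (0/9 proved); BetaPertH ⇐ (D1) ∧ (D4) ∧ CAP+tail; G-an2-4 gates asym, D1 and NE2/3/4.»

WHAT IS HERE ([folklore] throughout; every END is a call BY NAME of asym2's `Beta.RemainderConstCertified` §3 floor sockets on the box the
every-slope residue `CapSignsConstRoad.EverySlope` produces).
  * §1 THE SPLIT CERTIFICATE `uniformFloor_iff_eventualFloor_signs`: a uniform positive floor of a real sequence ⟺ an eventual positive floor
    from some `k₀` (TAIL side) ∧ the SIGN list below `k₀` (CAP side).  With `CapSignsConstRoad.betaAFH_iff_beta0Floor` this is the exact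
    division of labour of row CAP+tail for discrete asymptotic freedom on the every-slope road; `not_betaAFH_of_abelian_everySlope`: all
    signs without an eventual floor (cap3's abelian sequence) give NO (AF) — the TAIL side is load-bearing; its suppliers: a rate with a
    positive limit value (`eventualFloor_of_geomRate`) or, binf-free, asym2's `tail_floor_of_cert` (rate + ONE certified value).
  * §2 THE END STATEMENT NEEDS ONLY THE TAIL SIDE: `endpointExistence_of_eventualFloor_everySlope` — an EVENTUAL floor `f ≤ β⁰_{k+1}` (`k ≥ k₀`,
    ANY `k₀`, NO list below it), `EverySlope S γc`, (U), (L), (C) ⟹ `DagBinding.EndpointExistence C` (`eventualFormOfFloorConst` with `r := f/2`);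
    (0.31) needs the uniform floor (`CapSignsConstRoad.thm2Printed_of_beta0Floor_everySlope`) — the CAP is consumed by (0.31) ONLY, as on the
    `LimitForm` road (`Gaps/WeakestBetaCurrency.wOfLimitForm`); scheme form `exists_member_endpointExistence_of_eventualFloor` over g1-p2's `EpsFamily` (CAP-free).
  * §3 SUPPLIERS OF THE FLOOR BY NAME, met with the every-slope ENDs: the CAP-k row carrier `Beta.CapRows.Rows S.β0` (certified rational lower
    bounds `lo k ≤ β⁰_{k+1}`, `k ≤ k₀`; OWNER lineage b2b an5, socket custodian cap3) with the SIGN TEST `0 < m₀` of its minimum and ONE tail socket of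
    `Beta.CapRowsTail` — (M↑) `thm2Printed_of_rows_monotoneTailUp`, (M↓ + limit) `thm2Printed_of_rows_monotoneTailDown`, (contraction)
    `thm2Printed_of_rows_contractingTail` — and the rate road `thm2Printed_of_signs_everySlope` of the companion file; NO threshold, NO `binf`
    enclosure in the (M↑) case, ONE sign test in all cases.
    Also the LARGE-L supplier (AF-0-L) of the β-lead's `Beta.LargeL` (no list, no rate): `thm2Printed_of_logGrowth_everySlope`.
  * §4 The LINEAR road inherits the characterisation: under (AF-1) on `]0,γ₀]`, `BetaAFH β ↔` uniform positive floor of β⁰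
    (`betaAFH_iff_beta0Floor_of_af1`); on the `LimitForm` carrier `BetaAFH β ↔` the CAP sign list (`betaAFH_iff_signs_of_limitForm`).
  * §5 NON-VACUITY on asym2's witness `splitOne` (`β ≡ 1 = 1 + 0`): `everySlope_splitOne`, `betaAFH_constOne_via_floor`.
  * §6 SPLIT-FREE FORM (no one-loop split in the statements): `UniformAtZero β γc` (k-uniform continuity of β at the zero history;
    `everySlope_iff_uniformAtZero`), `thm2Printed_splitFree` ((0.31) ⟸ floor of `β_{k+1}(0,…,0)` + `UniformAtZero` + (C) + (U)),
    `betaAFH_iff_floorAtZero` — the lane's «weakest statement really used», written on the family β alone; and the scheme form with its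
    binder on the family (`exists_member_thm2Printed_of_floorAtZero`: members agree at the zero history).
FINE PRINT on «every-slope» (plan-2 reading R-4): every END here and in the companion file consumes `EverySlope` ∕ `UniformAtZero` at exactly ONE
slope `s := floor∕2` (the one-slope socket is asym2's `RemainderConstCertified.thm2Printed_of_floor_const`); the ∀-slope quantifier is the HYPOTHESIS
SHAPE because the floor's value is not a numeral in the tree (the remainder constant must be choosable AFTER the floor — [I] Thm 3 p. 264, [II]
p. 21), not because a proof needs many slopes; for Bałaban's FIXED split the residue of (0.31)'s lower half is (D4) at ONE slope `s < FLOOR(β⁰)∕2`.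
Nothing of Bałaban's is instantiated; every carrier field is a located UNPRINTED input for his (1.22); 0 sorry.

CITATION HEADER (tags CONTEXT ONLY).  [I] = T. Bałaban, Commun. Math. Phys. **109** (1987) [Balaban1987RG1]: Thm 2 p. 259 with (0.31) and its first
sentence (the END statement); (2.12)–(2.14) p. 268; Thm 3 p. 264.  NO floor, rate, monotonicity or finite-k value of (1.22) is printed in the series.
-/

namespace Summit.QuantumFields.BalabanUV.Gaps.CapTailFloors

open Literature.MathematicalPhysics.QuantumFieldTheory.Balaban1983to89
open Literature.MathematicalPhysics.QuantumFieldTheory.Balaban1983to89.FlowStep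
open Literature.MathematicalPhysics.QuantumFieldTheory.Balaban1983to89.FlowStepRuns
open Literature.MathematicalPhysics.QuantumFieldTheory.Balaban1983to89.DagBinding
open Literature.MathematicalPhysics.QuantumFieldTheory.Balaban1983to89.Beta.RemainderChain (RemainderConst)
open Literature.MathematicalPhysics.QuantumFieldTheory.Balaban1983to89.Beta.RemainderConstCertified
open Literature.MathematicalPhysics.QuantumFieldTheory.Balaban1983to89.Beta.RemainderResidue (remainderConst_restrict)
open Literature.MathematicalPhysics.QuantumFieldTheory.Balaban1983to89.Beta.RemainderResidueFamily (EpsFamily exists_remainderConst_of_epsFamily)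
open Summit.QuantumFields.BalabanUV.Gaps.CapSignsConstRoad
open Summit.QuantumFields.BalabanUV.Beta.CapRows (Rows)
open Summit.QuantumFields.BalabanUV.Beta.CapRowsTail
open Summit.QuantumFields.BalabanUV.Beta.RemainderExplicitSplitUnique (β0_eq_apply_zero β1_eq_sub_zero remainderConst_iff_family)
open Filter Topology

noncomputable section

variable {β : HBeta}

/-! ## §1 The CAP-vs-tail split certificate for a real sequence -/

/-- **UNIFORM FLOOR ⟺ EVENTUAL FLOOR ∧ SIGN LIST**: `∃ f > 0, ∀ k, f ≤ b_k` iff for some `k₀` there is an eventual positive floor from `k₀` (the TAIL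
side) and `0 < b_k` for `k < k₀` (the CAP side).  (⇒ `k₀ = 0`; ⇐ the minimum of the eventual floor and the finite list's positive floor
`CapSignsConstRoad.exists_pos_floor_of_signs`.) [folklore] -/
theorem uniformFloor_iff_eventualFloor_signs (b : ℕ → ℝ) :
    (∃ f : ℝ, 0 < f ∧ ∀ k, f ≤ b k) ↔
      ∃ k₀ : ℕ, (∃ f : ℝ, 0 < f ∧ ∀ k, k₀ ≤ k → f ≤ b k) ∧ ∀ k, k < k₀ → 0 < b k := by
  constructor
  · rintro ⟨f, hf, hF⟩
    exact ⟨0, ⟨f, hf, fun k _ => hF k⟩, fun k hk => absurd hk (Nat.not_lt_zero k)⟩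
  · rintro ⟨k₀, ⟨f, hf, hF⟩, hsign⟩
    obtain ⟨m₀, hm₀, hlist⟩ := exists_pos_floor_of_signs b k₀ hsign
    refine ⟨min f m₀, lt_min hf hm₀, fun k => ?_⟩
    rcases lt_or_ge k k₀ with hk | hk
    · exact (min_le_right _ _).trans (hlist k hk)
    · exact (min_le_left _ _).trans (hF k hk)

/-- **ROW CAP+tail FOR DISCRETE ASYMPTOTIC FREEDOM, SPLIT** (every-slope road): under `EverySlope S γc`, `BetaAFH β` iff for some `k₀` the one-loop
coefficients have an eventual positive floor from `k₀` (TAIL) and positive signs below `k₀` (CAP). [cite: Balaban1987RG1, (2.12)-(2.14) p.268] -/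
theorem betaAFH_iff_eventualFloor_signs (S : B12Beta.OneLoopSplit β) {γc : ℝ} (hrem : EverySlope S γc) :
    BetaAFH β ↔ ∃ k₀ : ℕ, (∃ f : ℝ, 0 < f ∧ ∀ k, k₀ ≤ k → f ≤ S.β0 k) ∧ ∀ k, k < k₀ → 0 < S.β0 k :=
  (betaAFH_iff_beta0Floor S hrem).trans (uniformFloor_iff_eventualFloor_signs S.β0)

/-- **SUPPLIER OF THE TAIL SIDE from a RATE WITH A POSITIVE LIMIT VALUE** (the `LimitForm` road's input, stated on the bare rate): `GeomRate b binf c₀ θ`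
with `0 ≤ θ < 1` and `0 < binf` ⟹ an eventual floor `binf/2 ≤ b_k` from some `k₀`.  (The binf-FREE supplier — rate + ONE certified value — is asym2's
`RemainderConstCertified.tail_floor_of_cert`.) [folklore] -/
theorem eventualFloor_of_geomRate {b : ℕ → ℝ} {binf c₀ θ : ℝ} (hconv : Beta.RateCertificate.GeomRate b binf c₀ θ) (hθ0 : 0 ≤ θ)
    (hθ1 : θ < 1) (hbinf : 0 < binf) : ∃ k₀ : ℕ, ∀ k, k₀ ≤ k → binf / 2 ≤ b k := by
  have hc₀ := hconv.const_nonneg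
  obtain ⟨k₀, hk₀⟩ := exists_pow_lt_of_lt_one (show 0 < binf / (2 * (c₀ + 1)) by positivity) hθ1
  refine ⟨k₀, fun k hk => ?_⟩
  have h1 := (abs_le.mp (hconv k)).1
  have h2 : θ ^ k ≤ θ ^ k₀ := pow_le_pow_of_le_one hθ0 hθ1.le hk
  have h3 : c₀ * θ ^ k ≤ (c₀ + 1) * θ ^ k₀ := by
    have := pow_nonneg hθ0 k
    nlinarith
  have h4 : (c₀ + 1) * θ ^ k₀ ≤ (c₀ + 1) * (binf / (2 * (c₀ + 1))) := mul_le_mul_of_nonneg_left hk₀.le (by linarith)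
  have h5 : (c₀ + 1) * (binf / (2 * (c₀ + 1))) = binf / 2 := by field_simp
  linarith

/-- **THE TAIL SIDE IS LOAD-BEARING (all signs, no floor ⟹ no (AF))**: a split whose one-loop part is cap3's ABELIAN sequence
`abelianCoeff L k = (L⁴−1)/(4L^{4(k+1)})` (`Beta.Certified`; every sign positive, `abelianCoeff_pos`, but NO uniform floor,
`not_exists_uniform_pos_lower_bound`) has NO discrete asymptotic freedom under `EverySlope` — the counterpart of the companion file's §4
(there the CAP side was load-bearing for a fixed remainder constant). [folklore] -/
theorem not_betaAFH_of_abelian_everySlope {L : ℕ} (hL : 2 ≤ L) (S : B12Beta.OneLoopSplit β)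
    (hS : ∀ k, S.β0 k = ((Beta.Certified.abelianCoeff L k : ℚ) : ℝ)) {γc : ℝ} (hrem : EverySlope S γc) : ¬ BetaAFH β :=
  fun h => by
    obtain ⟨b, hb, hF⟩ := (betaAFH_iff_beta0Floor S hrem).mp h
    exact Beta.Certified.not_exists_uniform_pos_lower_bound hL ⟨b, hb, fun k => (hF k).trans_eq (hS k)⟩

/-! ## §2 The END statement consumes only the TAIL side (eventual floor), on the every-slope road -/

/-- **`EndpointExistence C` FROM AN EVENTUAL FLOOR, every-slope road — NO CAP**: forward generation, an eventual floor `0 < f ≤ β⁰_{k+1}` for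
`k ≥ k₀` (ANY `k₀`; nothing asked below `k₀`), `EverySlope S γc`, the printed two-sided bound (U)∕(L) and (C) on `]0,γc]` ⟹ the END statement
(`RemainderConstCertified.eventualFormOfFloorConst` with `r := f/2` on the produced box, then `Assembly.EventualForm.endpointExistence`).
[cite: Balaban1987RG1, Thm 2 p.259 (first sentence)] -/
theorem endpointExistence_of_eventualFloor_everySlope {C : B12.Construction} (hgen : ForwardGenerated C β)
    (S : B12Beta.OneLoopSplit β) {γc f β' : ℝ} {k₀ : ℕ} (hf : 0 < f) (hF : ∀ k, k₀ ≤ k → f ≤ S.β0 k) (hrem : EverySlope S γc)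
    (hup : BetaUpperH β' γc β) (hlo : ∀ k, ∀ v ∈ Box γc k, -β' ≤ β k v) (hcont : BetaContH γc β) : EndpointExistence C := by
  obtain ⟨γ, hγ, hγle, hR⟩ := hrem _ (half_pos hf)
  exact (eventualFormOfFloorConst S hγ hF hR (half_lt_self hf) (fun k v hv => hup k v (box_mono hγle k hv))
    (fun k v hv => hlo k v (box_mono hγle k hv)) (fun k => (hcont k).mono (box_mono hγle k))).endpointExistence hgen

/-- Its `EventualForm` carrier has `b = f/2` and threshold scale `k₀` (no list below `k₀` was consumed). [folklore] -/
theorem eventualForm_consts_of_eventualFloor (S : B12Beta.OneLoopSplit β) {γ f β' : ℝ} {k₀ : ℕ} (hγ : 0 < γ) (hf : 0 < f)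
    (hF : ∀ k, k₀ ≤ k → f ≤ S.β0 k) (hR : RemainderConst S γ (f / 2)) (hup : BetaUpperH β' γ β)
    (hlo : ∀ k, ∀ v ∈ Box γ k, -β' ≤ β k v) (hcont : BetaContH γ β) :
    (eventualFormOfFloorConst S hγ hF hR (half_lt_self hf) hup hlo hcont).b = f / 2 ∧
      (eventualFormOfFloorConst S hγ hF hR (half_lt_self hf) hup hlo hcont).k₀ = k₀ := by
  refine ⟨?_, (eventualFormOfFloorConst_consts S hγ hF hR (half_lt_self hf) hup hlo hcont).2.1⟩
  rw [(eventualFormOfFloorConst_consts S hγ hF hR (half_lt_self hf) hup hlo hcont).1]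
  ring

/-- **SCHEME FORM OF THE END STATEMENT, CAP-FREE** (rung L1.2's currency): for a family `e ↦ (βf e, Sf e, Cf e)` indexed by the activity
parameter, g1-p2's `EpsFamily βf Sf` + the displayed binder `hβ0` (members agree at the zero history; a reading, never asserted) + an EVENTUAL
floor `0 < f ≤ b0 k` (`k ≥ k₀`, nothing below `k₀`) + per-member (U)∕(L)∕(C) + forward generation ⟹ SOME member has `EndpointExistence (Cf e)`
(member chosen at slope `f/2`). [cite: Balaban1987RG1, Thm 2 p.259 (first sentence) and Thm 3 p.264; Balaban1988RG2Cluster, p.21] -/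
theorem exists_member_endpointExistence_of_eventualFloor {βf : ℝ → HBeta} {Sf : (e : ℝ) → B12Beta.OneLoopSplit (βf e)}
    (hE : EpsFamily βf Sf) (Cf : ℝ → B12.Construction) (hgen : ∀ e, 0 < e → ForwardGenerated (Cf e) (βf e)) {b0 : ℕ → ℝ}
    (hβ0 : ∀ e, 0 < e → (Sf e).β0 = b0) {f : ℝ} {k₀ : ℕ} (hf : 0 < f) (hF : ∀ k, k₀ ≤ k → f ≤ b0 k) (γcf β'f : ℝ → ℝ)
    (hγcf : ∀ e, 0 < e → 0 < γcf e) (hup : ∀ e, 0 < e → BetaUpperH (β'f e) (γcf e) (βf e))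
    (hlo : ∀ e, 0 < e → ∀ k, ∀ v ∈ Box (γcf e) k, -β'f e ≤ βf e k v) (hcont : ∀ e, 0 < e → BetaContH (γcf e) (βf e)) :
    ∃ e : ℝ, 0 < e ∧ EndpointExistence (Cf e) := by
  obtain ⟨e, he, γ₀, hγ₀, hR⟩ := exists_remainderConst_of_epsFamily hE (half_pos hf)
  refine ⟨e, he, ?_⟩
  have hγ : 0 < min γ₀ (γcf e) := lt_min hγ₀ (hγcf e he)
  have hR' : RemainderConst (Sf e) (min γ₀ (γcf e)) (f / 2) := remainderConst_restrict (min_le_left _ _) hR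
  have hF' : ∀ k, k₀ ≤ k → f ≤ (Sf e).β0 k := by rw [hβ0 e he]; exact hF
  have hle : min γ₀ (γcf e) ≤ γcf e := min_le_right _ _
  exact (eventualFormOfFloorConst (Sf e) hγ hF' hR' (half_lt_self hf) (fun k v hv => hup e he k v (box_mono hle k hv))
    (fun k v hv => hlo e he k v (box_mono hle k hv)) (fun k => (hcont e he k).mono (box_mono hle k))).endpointExistence (hgen e he)

/-! ## §3 Suppliers of the floor by name: the CAP-k row carrier with ONE tail socket, met with the every-slope ENDs -/

/-- **ROWS × (M↑) ⟹ THEOREM 2 AS PRINTED, every-slope road**: certified rows `lo k ≤ β⁰_{k+1}` (`k ≤ k₀`, `Beta.CapRows.Rows S.β0`) whose minimum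
passes the SIGN TEST `0 < m₀`, a non-decreasing tail of β⁰ from `k₀` (`Beta.CapRowsTail.MonotoneTailUp`), `EverySlope S γc`, (C), (U) ⟹
`B12.Thm2Printed C L` — the floor is `m₀` itself (`CapRowsTail.floor_of_rows_monotoneTailUp`); NO threshold, NO `binf`, NO rate.
[cite: Balaban1987RG1, Thm 2 p.259 with (0.31)] -/
theorem thm2Printed_of_rows_monotoneTailUp {C : B12.Construction} (hgen : ForwardGenerated C β) {L : ℝ} (hL : 1 < L)
    (S : B12Beta.OneLoopSplit β) (c : Rows S.β0) (hm₀ : 0 < c.m₀) (h : MonotoneTailUp S.β0 c.k₀) {γc β' : ℝ}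
    (hrem : EverySlope S γc) (hcont : BetaContH γc β) (hup : BetaUpperH β' γc β) : B12.Thm2Printed C L :=
  thm2Printed_of_beta0Floor_everySlope hgen hL S (by exact_mod_cast hm₀) (floor_of_rows_monotoneTailUp c h) hrem hcont hup

/-- `BetaAFH β` from ROWS × (M↑) × `EverySlope` with the sign test `0 < m₀`. [folklore] -/
theorem betaAFH_of_rows_monotoneTailUp (S : B12Beta.OneLoopSplit β) (c : Rows S.β0) (hm₀ : 0 < c.m₀) (h : MonotoneTailUp S.β0 c.k₀)
    {γc : ℝ} (hrem : EverySlope S γc) : BetaAFH β :=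
  betaAFH_of_beta0Floor_everySlope S (by exact_mod_cast hm₀) (floor_of_rows_monotoneTailUp c h) hrem

/-- **ROWS × (M↓ + limit) ⟹ THEOREM 2 AS PRINTED, every-slope road**: rows with `0 < m₀`, a non-increasing tail from `k₀` with limit `binf > 0`,
`EverySlope`, (C), (U) ⟹ `B12.Thm2Printed C L` (floor `min m₀ binf`, `CapRowsTail.floor_of_rows_monotoneTailDown`).
[cite: Balaban1987RG1, Thm 2 p.259 with (0.31)] -/
theorem thm2Printed_of_rows_monotoneTailDown {C : B12.Construction} (hgen : ForwardGenerated C β) {L : ℝ} (hL : 1 < L)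
    (S : B12Beta.OneLoopSplit β) (c : Rows S.β0) (hm₀ : 0 < c.m₀) {binf : ℝ} (hbinf : 0 < binf) (h : MonotoneTailDown S.β0 c.k₀)
    (hlim : Tendsto S.β0 atTop (𝓝 binf)) {γc β' : ℝ} (hrem : EverySlope S γc) (hcont : BetaContH γc β)
    (hup : BetaUpperH β' γc β) : B12.Thm2Printed C L :=
  thm2Printed_of_beta0Floor_everySlope hgen hL S (lt_min (by exact_mod_cast hm₀) hbinf) (floor_of_rows_monotoneTailDown c h hlim)
    hrem hcont hup

/-- **ROWS × CONTRACTION ⟹ THEOREM 2 AS PRINTED, every-slope road**: rows with `0 < m₀`, contraction of the tail towards `binf` at ratio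
`θ ∈ [0,1]` from `k₀` with the datum `|β⁰_{k₀+1} − binf| ≤ D` and `θ·D < binf`, `EverySlope`, (C), (U) ⟹ `B12.Thm2Printed C L` (floor
`min m₀ (binf − θD)`, `CapRowsTail.floor_of_rows_contractingTail`; no sharp rate). [cite: Balaban1987RG1, Thm 2 p.259 with (0.31)] -/
theorem thm2Printed_of_rows_contractingTail {C : B12.Construction} (hgen : ForwardGenerated C β) {L : ℝ} (hL : 1 < L)
    (S : B12Beta.OneLoopSplit β) (c : Rows S.β0) (hm₀ : 0 < c.m₀) {binf θ D : ℝ} (h : ContractingTail S.β0 binf θ c.k₀)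
    (hθ0 : 0 ≤ θ) (hθ1 : θ ≤ 1) (hD : |S.β0 c.k₀ - binf| ≤ D) (hgap : θ * D < binf) {γc β' : ℝ} (hrem : EverySlope S γc)
    (hcont : BetaContH γc β) (hup : BetaUpperH β' γc β) : B12.Thm2Printed C L :=
  thm2Printed_of_beta0Floor_everySlope hgen hL S (lt_min (by exact_mod_cast hm₀) (by linarith))
    (floor_of_rows_contractingTail c h hθ0 hθ1 hD) hrem hcont hup

/-- The END statement from ROWS × (M↑) needs NO sign test at all when read as an EVENTUAL floor… except that the floor VALUE must be positive:
with `0 < lo k₀` alone (the LAST row's sign) and (M↑) from `k₀`, `EndpointExistence C` follows on the every-slope road — the earlier rows are not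
consumed. [cite: Balaban1987RG1, Thm 2 p.259 (first sentence)] -/
theorem endpointExistence_of_lastRow_monotoneTailUp {C : B12.Construction} (hgen : ForwardGenerated C β)
    (S : B12Beta.OneLoopSplit β) (c : Rows S.β0) (hlast : 0 < c.lo c.k₀) (h : MonotoneTailUp S.β0 c.k₀) {γc β' : ℝ}
    (hrem : EverySlope S γc) (hup : BetaUpperH β' γc β) (hlo : ∀ k, ∀ v ∈ Box γc k, -β' ≤ β k v) (hcont : BetaContH γc β) :
    EndpointExistence C :=
  endpointExistence_of_eventualFloor_everySlope hgen S (f := ((c.lo c.k₀ : ℚ) : ℝ)) (k₀ := c.k₀) (by exact_mod_cast hlast)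
    (fun k hk => (c.lo_le c.k₀ le_rfl).trans (le_of_monotoneTailUp h k hk)) hrem hup hlo hcont

/-- **SUPPLIER (AF-0-L), the LARGE-L road of the β-lead's `Beta.LargeL`, met with the every-slope (0.31) END**: the uniform one-loop law
`LogGrowthLower β0 b A` (`b·log L − A ≤ β⁰_{k+1}(L)` for all k, L ≥ 2 — (D1)-type analysis, OPEN; a binder) at a block size `L ≥ L₁(b, A, b₀)` gives
the floor `2b₀ ≤ β⁰_{k+1}` (`LargeL.af0_all`) — NO list, NO rate — hence with `EverySlope S γc`, (C), (U): `B12.Thm2Printed C Lr` for every real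
`Lr > 1` (the tree's `LargeL.thm2Printed` is the same with a FIXED remainder constant `r ≤ b₀`). [cite: Balaban1987RG1, Thm 2 p.259 with (0.31)] -/
theorem thm2Printed_of_logGrowth_everySlope {β0 : ℕ → ℕ → ℝ} {b A b₀ : ℝ} {L : ℕ} (S : B12Beta.OneLoopSplit β)
    (h : Beta.LargeL.LogGrowthLower β0 b A) (hb : 0 < b) (hL : Beta.LargeL.L₁ b A b₀ ≤ L) (hS : ∀ k, S.β0 k = β0 L k)
    (hb₀ : 0 < b₀) {γc β' : ℝ} (hrem : EverySlope S γc) (hcont : BetaContH γc β) (hup : BetaUpperH β' γc β)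
    {C : B12.Construction} (hgen : ForwardGenerated C β) {Lr : ℝ} (hLr : 1 < Lr) : B12.Thm2Printed C Lr :=
  thm2Printed_of_beta0Floor_everySlope hgen hLr S (by positivity) (Beta.LargeL.af0_all S h hb hL hS) hrem hcont hup

/-! ## §4 The linear road inherits the characterisation -/

/-- **On the LINEAR road too, CAP+tail for discrete asymptotic freedom IS the uniform positive floor of β⁰**: under (AF-1) `|β¹_{k+1}(p)| ≤ C·p_k` on
`]0,γ₀]`-histories, `BetaAFH β ↔ ∃ b > 0, ∀ k, b ≤ β⁰_{k+1}` (`CapSignsConstRoad.betaAFH_iff_beta0Floor` ∘ `everySlope_of_af1`).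
[cite: Balaban1987RG1, §1 p.264 and (2.12)-(2.14) p.268] -/
theorem betaAFH_iff_beta0Floor_of_af1 (S : B12Beta.OneLoopSplit β) {C γ₀ : ℝ} (hγ₀ : 0 < γ₀) (hC : 0 ≤ C)
    (hAF1 : ∀ k (p : Fin (k + 1) → ℝ), p ∈ B12Beta.HistBox γ₀ k → |S.β1 k p| ≤ C * p (Fin.last k)) :
    BetaAFH β ↔ ∃ b : ℝ, 0 < b ∧ ∀ k, b ≤ S.β0 k :=
  betaAFH_iff_beta0Floor S (everySlope_of_af1 S hγ₀ hC hAF1)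

/-- **The `LimitForm` carrier has the every-slope currency** (its (AF-1) field): `EverySlope D.S D.γ₀`. [folklore] -/
theorem everySlope_of_limitForm (D : Beta.Assembly.LimitForm β) : EverySlope D.S D.γ₀ :=
  everySlope_of_af1 D.S D.γ₀_pos D.Cr_nonneg D.af1

/-- **ON THE `LimitForm` ROAD, DISCRETE ASYMPTOTIC FREEDOM ⟺ THE CAP'S SIGN LIST** (gen 0's `Gaps/CapTailSigns.betaAFH_of_signs` is ⟸; ⟹ is the
floor characterisation): `LimitForm β` ⟹ (`BetaAFH β ↔ ∀ k < k₀, 0 < β⁰_{k+1}`), `k₀ = LimitForm.k₀` the rate's threshold scale.  So for a datum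
carrying the tail, the CAP sign list is not merely sufficient but EXACTLY what (AF) adds. [cite: Balaban1987RG1, Thm 2 p.259 and (2.12)-(2.14) p.268] -/
theorem betaAFH_iff_signs_of_limitForm (D : Beta.Assembly.LimitForm β) :
    BetaAFH β ↔ ∀ k, k < D.k₀ → 0 < D.S.β0 k := by
  rw [betaAFH_iff_beta0Floor D.S (everySlope_of_limitForm D)]
  exact ⟨fun ⟨b, hb, hF⟩ k _ => hb.trans_le (hF k), fun h => D.exists_uniform_beta0_lower h⟩

/-! ## §5 Non-vacuity on asym2's witness `splitOne` (`β_{k+1} ≡ 1`, split `1 + 0`) -/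

/-- The zero remainder has the every-slope currency on every box. [folklore] -/
theorem everySlope_splitOne {γc : ℝ} (hγc : 0 < γc) : EverySlope Beta.Assembly.Witness.splitOne γc := fun _ hs =>
  ⟨γc, hγc, le_rfl, fun k p _ => by
    change |(0 : ℝ)| ≤ _
    rw [abs_zero]
    exact hs.le⟩

/-- `BetaAFH constOne` THROUGH the floor road (floor `1 ≤ β⁰ ≡ 1`, `everySlope_splitOne`) — the §2a END of the companion file fires on an
inhabited datum. [folklore] -/
theorem betaAFH_constOne_via_floor : BetaAFH Beta.Assembly.Witness.constOne :=
  betaAFH_of_beta0Floor_everySlope Beta.Assembly.Witness.splitOne one_pos (fun _ => le_rfl) (everySlope_splitOne one_pos)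

/-! ## §6 SPLIT-FREE FORM: what the lower half of (0.31) consumes of a history-dependent family `β`, with no one-loop split in the statement -/

/-- **`UniformAtZero β γc` — k-UNIFORM CONTINUITY OF `β` AT THE ZERO HISTORY along boxes**: for every `s > 0` a box `]0,γ] ⊆ ]0,γc]` with
`|β_{k+1}(p) − β_{k+1}(0,…,0)| ≤ s` for all k and all `p ∈ ]0,γ]^{k+1}`.  For a family admitting the printed one-loop split this IS the every-slope
currency of (D4) (`everySlope_iff_uniformAtZero`; d4-p3's `Beta.RemainderExplicitSplitUnique.remainderConst_iff_family` is the fixed-`r` form).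
A PREDICATE (hypothesis shape), never asserted; for Bałaban's (1.22) it is located and unprinted ([I] p. 264 «all derivatives bounded» would give the
Lipschitz form). [cite: Balaban1987RG1, §1 p.264 and (2.12)-(2.14) p.268] -/
def UniformAtZero (β : HBeta) (γc : ℝ) : Prop :=
  ∀ s : ℝ, 0 < s → ∃ γ : ℝ, 0 < γ ∧ γ ≤ γc ∧
    ∀ (k : ℕ) (p : Fin (k + 1) → ℝ), p ∈ B12Beta.HistBox γ k → |β k p - β k (fun _ : Fin (k + 1) => 0)| ≤ s

/-- **`EverySlope S γc ↔ UniformAtZero β γc`** for any printed split `S` of `β` (the remainder is `β − β(0)`). [cite: Balaban1987RG1, (2.12)-(2.14) p.268] -/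
theorem everySlope_iff_uniformAtZero (S : B12Beta.OneLoopSplit β) {γc : ℝ} : EverySlope S γc ↔ UniformAtZero β γc :=
  forall_congr' fun _ => forall_congr' fun _ => exists_congr fun _ => and_congr_right fun _ => and_congr_right fun _ =>
    remainderConst_iff_family S

/-- **(AF-0) ON A BOX, SPLIT-FREE**: a floor `b ≤ β_{k+1}(0,…,0)` (all k) and the modulus `|β_{k+1}(p) − β_{k+1}(0)| ≤ s` on `]0,γ]^{k+1}` give
`BetaLowerH (b − s) γ β`. [folklore] -/
theorem betaLowerH_of_floorAtZero {γ b s : ℝ} (hF : ∀ k, b ≤ β k (fun _ : Fin (k + 1) => 0))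
    (hmod : ∀ (k : ℕ) (p : Fin (k + 1) → ℝ), p ∈ B12Beta.HistBox γ k → |β k p - β k (fun _ : Fin (k + 1) => 0)| ≤ s) :
    BetaLowerH (b - s) γ β := fun k v hv => by
  have h1 := (abs_le.mp (hmod k v (histBox_of_mem_box hv))).1
  linarith [hF k]

/-- **[Balaban1987RG1] THEOREM 2 AS PRINTED, SPLIT-FREE INPUT LIST**: forward generation by `β`, `1 < L`, (i) ONE-LOOP ASYMPTOTIC FREEDOM UNIFORM IN
THE SCALE `∃ b > 0, ∀ k, b ≤ β_{k+1}(0,…,0)` (= CAP+tail: `betaAFH_iff_beta0Floor` with d4-p3's `β0_eq_apply_zero`), (ii) `UniformAtZero β γc` (= the residue: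
(D4) every-slope ∕ (AF-1)), (iii) (C) and (U) on `]0,γc]` ⟹ `B12.Thm2Printed C L` (`FlowStepRuns.thm2Printed_of_boxBoundsH` with `b − b/2` on the
produced box).  Nothing here is supplied by print for (1.22). [cite: Balaban1987RG1, Thm 2 p.259 with (0.31)] -/
theorem thm2Printed_splitFree {C : B12.Construction} (hgen : ForwardGenerated C β) {L : ℝ} (hL : 1 < L) {γc b β' : ℝ}
    (hb : 0 < b) (hF : ∀ k, b ≤ β k (fun _ : Fin (k + 1) => 0)) (hmod : UniformAtZero β γc) (hcont : BetaContH γc β)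
    (hup : BetaUpperH β' γc β) : B12.Thm2Printed C L := by
  obtain ⟨γ, hγ, hγle, hm⟩ := hmod _ (half_pos hb)
  have hlo : BetaLowerH (b - b / 2) γ β := betaLowerH_of_floorAtZero hF hm
  have hmem : (fun _ : Fin (0 + 1) => γ) ∈ Box γ 0 := mem_box.mpr fun _ => ⟨hγ, le_rfl⟩
  exact thm2Printed_of_boxBoundsH hgen hL hγ (by linarith) ((hlo 0 _ hmem).trans (hup 0 _ (box_mono hγle 0 hmem)))
    (fun k => (hcont k).mono (box_mono hγle k)) hlo (fun k v hv => hup k v (box_mono hγle k hv))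

/-- **SPLIT-FREE CHARACTERISATION**: under `UniformAtZero β γc`, `BetaAFH β ↔ ∃ b > 0, ∀ k, b ≤ β_{k+1}(0,…,0)`. [folklore] -/
theorem betaAFH_iff_floorAtZero {γc : ℝ} (hmod : UniformAtZero β γc) :
    BetaAFH β ↔ ∃ b : ℝ, 0 < b ∧ ∀ k, b ≤ β k (fun _ : Fin (k + 1) => 0) := by
  refine ⟨fun ⟨γ₀, hγ₀, b, hb, hlo⟩ => ?_, fun ⟨b, hb, hF⟩ => ?_⟩
  · obtain ⟨γ, hγ, -, hm⟩ := hmod _ (half_pos hb)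
    refine ⟨b / 2, half_pos hb, fun k => ?_⟩
    have hv : (fun _ : Fin (k + 1) => min γ γ₀) ∈ Box γ₀ k := mem_box.mpr fun _ => ⟨lt_min hγ hγ₀, min_le_right _ _⟩
    have h1 := hlo k _ hv
    have h2 := (abs_le.mp (hm k _ fun _ => ⟨lt_min hγ hγ₀, min_le_left _ _⟩)).2
    linarith
  · obtain ⟨γ, hγ, -, hm⟩ := hmod _ (half_pos hb)
    exact ⟨γ, hγ, b - b / 2, by linarith, betaLowerH_of_floorAtZero hF hm⟩

/-- **THE SCHEME FORM WITH ITS BINDER WRITTEN ON THE FAMILY** (plan-2 reading R-2 made kernel): the displayed binder of the companion file's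
`exists_member_thm2Printed_of_beta0Floor` — «the members' one-loop coefficients are common» — is the split-free clause «the members' β-functions
AGREE AT THE ZERO HISTORY»: `∀ e > 0, ∀ k, βf e k (0,…,0) = b0 k` (d4-p3's `RemainderExplicitSplitUnique.β0_eq_apply_zero`).  With it: `EpsFamily` + a uniform positive floor of `b0` +
per-member (C), (U) + forward generation ⟹ some member satisfies Theorem 2 as printed. [cite: Balaban1987RG1, Thm 2 p.259 with (0.31) and Thm 3 p.264] -/
theorem exists_member_thm2Printed_of_floorAtZero {βf : ℝ → HBeta} {Sf : (e : ℝ) → B12Beta.OneLoopSplit (βf e)}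
    (hE : EpsFamily βf Sf) (Cf : ℝ → B12.Construction) (hgen : ∀ e, 0 < e → ForwardGenerated (Cf e) (βf e)) {L : ℝ}
    (hL : 1 < L) {b0 : ℕ → ℝ} (hzero : ∀ e, 0 < e → ∀ k, βf e k (fun _ : Fin (k + 1) => 0) = b0 k) {b : ℝ} (hb : 0 < b)
    (hF : ∀ k, b ≤ b0 k) (γcf β'f : ℝ → ℝ) (hγcf : ∀ e, 0 < e → 0 < γcf e) (hcont : ∀ e, 0 < e → BetaContH (γcf e) (βf e))
    (hup : ∀ e, 0 < e → BetaUpperH (β'f e) (γcf e) (βf e)) : ∃ e : ℝ, 0 < e ∧ B12.Thm2Printed (Cf e) L :=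
  exists_member_thm2Printed_of_beta0Floor hE Cf hgen hL
    (fun e he => funext fun k => (β0_eq_apply_zero (Sf e) k).trans (hzero e he k)) hb hF γcf β'f hγcf hcont hup

end

end Summit.QuantumFields.BalabanUV.Gaps.CapTailFloors
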